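import Mathlib
import Summits.Ventures.PercRepro2.Defs
import Summits.Ventures.PercRepro2.Harris
import Summits.Ventures.PercRepro2.TReduction

/-!
# The coefficients of the antipodal expansion (mine-a g49)

Closing out the pinning recursion `TReduction.kform_pin`, the antipodal sum `K_D(p)` expands over
the pinned base cases `(D', a')` with the coefficients
`coef D D' a' p = [D ⊆ D'] · Π_{e ∈ D' \ D} p_e (1 − p_e) · Π_{e ∉ D'} (p_e if a' e else 1 − p_e)²`.
This file defines them and proves the two facts a certificate needs: the coefficients satisfy
the same pinning recursion as `K` (`coef_pin`), and at a base point (`a₀` is `0/1`-valued off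
`D`) they are `1` exactly for the base case `(D, a₀)` itself and `0` otherwise
(`coef_base_one`, `coef_base_zero`). `THAntipodalPair` builds the certificate on top of this.
-/

namespace Summit.Ventures.PercRepro2

namespace THAntipodalPair

open Finset TReduction

section Coef

variable {E : Type*} [Fintype E] [DecidableEq E] {R : Type*} [CommRing R]

/-- The coefficient of the pinned base case `(D', a')` in the expansion of `K_D(p)`:
`[D ⊆ D'] · Π_{e ∈ D' \ D} p_e (1 − p_e) · Π_{e ∉ D'} (p_e if a' e else 1 − p_e)²`. -/
def coef (D D' : Finset E) (a' : Config E) (p : E → R) : R :=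
  if D ⊆ D' then (∏ e ∈ D' \ D, p e * (1 - p e)) * ∏ e ∈ univ \ D', (edgeFactor (p e) (a' e)) ^ 2
  else 0

omit [Fintype E] in
/-- The `p(1 − p)` product over a set not containing `g` is unchanged by an update at `g`. -/
lemma prod_pq_update_of_not_mem (p : E → R) {F : Finset E} {g : E} (hg : g ∉ F) (v : R) :
    ∏ e ∈ F, (Function.update p g v e * (1 - Function.update p g v e)) =
      ∏ e ∈ F, (p e * (1 - p e)) := by
  apply prod_congr rfl
  intro x hx
  have hxg : x ≠ g := by rintro rfl; exact hg hx
  rw [Function.update_of_ne hxg]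

omit [Fintype E] in
/-- The square product over a set not containing `g` is unchanged by an update at `g`. -/
lemma prod_sq_update_of_not_mem (p : E → R) (a' : Config E) {F : Finset E} {g : E} (hg : g ∉ F)
    (v : R) : ∏ e ∈ F, (edgeFactor (Function.update p g v e) (a' e)) ^ 2 =
      ∏ e ∈ F, (edgeFactor (p e) (a' e)) ^ 2 := by
  apply prod_congr rfl
  intro x hx
  have hxg : x ≠ g := by rintro rfl; exact hg hx
  rw [Function.update_of_ne hxg]

/-- **The pinning recursion of the coefficients** (for `g ∉ D`):
`c^{D,p} = (1 − p g)² c^{D,p[g↦0]} + (p g)² c^{D,p[g↦1]} + p g (1 − p g) c^{D ∪ {g},p}`. -/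
theorem coef_pin (D D' : Finset E) (a' : Config E) (p : E → R) {g : E} (hg : g ∉ D) :
    coef D D' a' p =
      (1 - p g) ^ 2 * coef D D' a' (Function.update p g 0)
        + p g ^ 2 * coef D D' a' (Function.update p g 1)
        + p g * (1 - p g) * coef (insert g D) D' a' p := by
  unfold coef
  by_cases hgD' : g ∈ D'
  · -- `g ∈ D' \ D`: only the third term survives
    by_cases hDD' : D ⊆ D'
    · have hins : insert g D ⊆ D' := insert_subset hgD' hDD'
      have hgDD' : g ∈ D' \ D := mem_sdiff.2 ⟨hgD', hg⟩
      have hsd : D' \ insert g D = (D' \ D).erase g := by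
        ext x; simp only [mem_sdiff, mem_insert, not_or, mem_erase]; tauto
      simp only [hDD', hins, if_true]
      rw [hsd, ← mul_prod_erase (D' \ D) (fun e => p e * (1 - p e)) hgDD',
        ← mul_prod_erase (D' \ D)
          (fun e => Function.update p g 0 e * (1 - Function.update p g 0 e)) hgDD',
        ← mul_prod_erase (D' \ D)
          (fun e => Function.update p g 1 e * (1 - Function.update p g 1 e)) hgDD']
      simp only [Function.update_self, mul_zero, zero_mul, sub_zero, sub_self, zero_add]
      ring
    · have hins : ¬ insert g D ⊆ D' := fun h => hDD' (subset_trans (subset_insert g D) h)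
      simp [hDD', hins]
  · -- `g ∉ D'`: the first two terms reproduce the square factor at `g`, the third vanishes
    have hins : ¬ insert g D ⊆ D' := fun h => hgD' (h (mem_insert_self g D))
    by_cases hDD' : D ⊆ D'
    · have hgU : g ∈ univ \ D' := mem_sdiff.2 ⟨mem_univ g, hgD'⟩
      have hgN : g ∉ D' \ D := fun h => hgD' (mem_sdiff.1 h).1
      simp only [hDD', hins, if_true, if_false, mul_zero, add_zero]
      rw [← mul_prod_erase (univ \ D') (fun e => (edgeFactor (p e) (a' e)) ^ 2) hgU,
        ← mul_prod_erase (univ \ D')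
          (fun e => (edgeFactor (Function.update p g 0 e) (a' e)) ^ 2) hgU,
        ← mul_prod_erase (univ \ D')
          (fun e => (edgeFactor (Function.update p g 1 e) (a' e)) ^ 2) hgU,
        prod_sq_update_of_not_mem p a' (notMem_erase g _) 0,
        prod_sq_update_of_not_mem p a' (notMem_erase g _) 1,
        prod_pq_update_of_not_mem p hgN 0, prod_pq_update_of_not_mem p hgN 1]
      simp only [Function.update_self]
      cases a' g <;> simp only [edgeFactor, Bool.false_eq_true, if_false, if_true] <;> ring
    · simp [hDD', hins]

end Coef

section Values

variable {E : Type*} [Fintype E] [DecidableEq E] {R : Type*} [Field R]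

/-- The `0/1` weight vector of a pinning pattern. -/
def pinA (a : Config E) : E → R := fun x => if a x then 1 else 0

omit [Fintype E] [DecidableEq E] in
/-- `pinA` is `0/1`-valued. -/
lemma pinA_zero_or_one (a : Config E) (x : E) :
    (pinA a x : R) = 0 ∨ (pinA a x : R) = 1 := by
  unfold pinA; by_cases h : a x <;> simp [h]

/-- `kform` over `D` only sees the weights off `D`. -/
lemma kform_congr_off (Q U e : Set (Config E)) (D : Finset E) {p q : E → R}
    (h : ∀ x, x ∉ D → p x = q x) : kform Q U e D p = kform Q U e D q := by
  unfold kform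
  apply sum_congr rfl
  intro σ _
  have hpin : ∀ τ : Config E, pinD p D τ = pinD q D τ := by
    intro τ; funext x; unfold pinD
    by_cases hx : x ∈ D
    · simp [hx]
    · simp [hx, h x hx]
  rw [hpin, hpin]

/-- The main base case does not depend on the weights at all. -/
lemma kform_univ_const (Q U e : Set (Config E)) (p q : E → R) :
    kform Q U e univ p = kform Q U e univ q :=
  kform_congr_off Q U e univ fun x hx => absurd (mem_univ x) hx

omit [Fintype E] in
/-- A factor of a base point: `edgeFactor (a₀ x) (a' x)` is `1` when `a₀ x` matches the pattern
`a'` at `x`. -/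
lemma edgeFactor_of_match {a₀ : R} {b : Bool} (h : a₀ = if b then 1 else 0) :
    edgeFactor a₀ b = 1 := by
  subst h; cases b <;> simp [edgeFactor]

omit [Fintype E] in
/-- … and `0` when it is the other `0/1` value. -/
lemma edgeFactor_of_not_match {a₀ : R} {b : Bool} (h01 : a₀ = 0 ∨ a₀ = 1)
    (h : a₀ ≠ if b then 1 else 0) : edgeFactor a₀ b = 0 := by
  cases b <;> rcases h01 with rfl | rfl <;> simp_all [edgeFactor]

/-- **The coefficients at a base point, matching case**: `coef D D a' a₀ = 1` when `a₀` matches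
the pattern `a'` off `D`. -/
theorem coef_base_one (D : Finset E) (a' : Config E) (a₀ : E → R)
    (hm : ∀ x, x ∉ D → a₀ x = if a' x then 1 else 0) : coef D D a' a₀ = 1 := by
  unfold coef
  rw [if_pos (Subset.refl D), sdiff_self]
  simp only [bot_eq_empty, prod_empty, one_mul]
  apply prod_eq_one
  intro x hx
  rw [edgeFactor_of_match (hm x (mem_sdiff.1 hx).2), one_pow]

/-- **The coefficients at a base point, the other cases**: `coef D D' a' a₀ = 0` when `a₀` is
`0/1`-valued off `D` and either `D ≠ D'` or `a₀` does not match `a'` off `D`. -/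
theorem coef_base_zero (D D' : Finset E) (a' : Config E) (a₀ : E → R)
    (h01 : ∀ x, x ∉ D → a₀ x = 0 ∨ a₀ x = 1)
    (h : ¬ (D = D' ∧ ∀ x, x ∉ D → a₀ x = if a' x then 1 else 0)) : coef D D' a' a₀ = 0 := by
  unfold coef
  by_cases hDD' : D ⊆ D'
  · rw [if_pos hDD']
    by_cases heq : D = D'
    · subst heq
      have hm : ¬ ∀ x, x ∉ D → a₀ x = if a' x then 1 else 0 := fun hm => h ⟨rfl, hm⟩
      push Not at hm
      obtain ⟨x, hxD, hx⟩ := hm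
      apply mul_eq_zero_of_right
      apply prod_eq_zero (i := x) (mem_sdiff.2 ⟨mem_univ x, hxD⟩)
      rw [edgeFactor_of_not_match (h01 x hxD) hx]
      simp
    · obtain ⟨x, hx⟩ : (D' \ D).Nonempty := by
        rw [nonempty_iff_ne_empty]
        intro h'
        exact heq (Subset.antisymm hDD' (sdiff_eq_empty_iff_subset.1 h'))
      apply mul_eq_zero_of_left
      apply prod_eq_zero hx
      rcases h01 x (mem_sdiff.1 hx).2 with h' | h' <;> rw [h'] <;> ring
  · rw [if_neg hDD']

/-- The antipodal patterns cannot both be matched on a nonempty `S` (off `D = univ \ S`). -/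
lemma not_match_both (S : Finset E) (hS : S.Nonempty) (a : Config E) (a₀ : E → R)
    (h1 : ∀ x, x ∉ univ \ S → a₀ x = if a x then 1 else 0)
    (h2 : ∀ x, x ∉ univ \ S → a₀ x = if (!a x) then 1 else 0) : False := by
  obtain ⟨x, hx⟩ := hS
  have hxn : x ∉ univ \ S := fun h => (mem_sdiff.1 h).2 hx
  have e1 := h1 x hxn
  have e2 := h2 x hxn
  rw [e1] at e2
  cases hax : a x <;> simp [hax] at e2

end Values

end THAntipodalPair

end Summit.Ventures.PercRepro2
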